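import Summits.ValiantsHypothesis.ValiantsHypothesis.Theorems.DefinabilityGapSupportRung
import HarnessLib

/-!
# DefinabilityGap — the shifted block permanents `P_c − α` are pairwise non-associated PRIMES of `ℂ[y]`

Route `route-ValiantsHypothesis-DefinabilityGap` (decomp-valiant cycle 1, lens 5: hardness–randomness / PIT axis); the
algebra behind the two-term rung `DefinabilityGapTwoTermRung` (census cells F4 / W10 = `KIPlantedHittingRO`,
stmt-ValiantsHypothesis-23704, and W5), filed in support of the residual `KIPlantedHitting` (stmt-ValiantsHypothesis-23547).
`G_m : y ↦ (P_c(y))_{c ∈ 𝔽_q³}`, `P_c = per_m(y|S_c)` (`kiPer`, `DefinabilityGapAffineRung`).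

* `perPoly_sub_C_irreducible`: `per_n − a` is irreducible over any integral domain, for every constant `a` — von zur
  Gathen's variable-splitting proof of the irreducibility of `per_n` [Vonzurgathen1987, Thm. 3.4] run for the shifted
  polynomial (the constant term never meets a permutation monomial, `vars_factor_perPoly_sub_C_trivial`).
* `prime_rename_of_injective`: primality survives renaming along an injective map of variables; hence
  `kiPer_sub_C_prime`: every `P_c − α` is a prime element of `ℂ[y] = MvPolynomial (𝔽_q × 𝔽_q) ℂ` (`m ≥ 1`).
* `associated_kiPer_sub_C_iff` / `kiPer_sub_C_dvd_iff` (`m ≥ 3`): `P_c − α ∣ P_{c'} − α'` iff `(c, α) = (c', α')` (read off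
  the diagonal monomial of `c`, which no other block contains since two quadratic curves share `≤ 2` cells).
* `aeval_kiPer_eq_zero_iff`: each `P_c` is transcendental (`h(P_c) = 0 ⇒ h = 0`).
0 sorry.
-/

noncomputable section

open MvPolynomial
open scoped Polynomial
open Literature.Computability.AlgebraicComplexity Literature.Computability.MetaComplexity

namespace Summit.ValiantsHypothesis.ValiantsHypothesis.Theorems.DefinabilityGapShiftedPrimes

open Summit.ValiantsHypothesis.ValiantsHypothesis.Theorems.DefinabilityGapAffineRung
open Summit.ValiantsHypothesis.ValiantsHypothesis.Theorems.DefinabilityGapSupportRung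

/-! ## 1. `per_n − a` is irreducible (von zur Gathen's argument, shifted) -/

section Shifted

variable {n : Type*} [Fintype n] [DecidableEq n] {R : Type*} [CommRing R] [IsDomain R]

/-- A permutation monomial is a nonzero exponent vector (`n` non-empty). [folklore] -/
theorem permMonomial_ne_zero [Nonempty n] (ρ : Equiv.Perm n) : permMonomial ρ ≠ 0 := by
  obtain ⟨i⟩ := ‹Nonempty n›
  intro h
  have := DFunLike.congr_fun h (ρ i, i)
  rw [permMonomial_apply, if_pos rfl] at this
  exact one_ne_zero this

omit [IsDomain R] in
/-- The permutation monomials keep coefficient `1` in `per_n − a`. [folklore] -/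
theorem coeff_permMonomial_perPoly_sub_C [Nonempty n] (a : R) (ρ : Equiv.Perm n) :
    coeff (permMonomial ρ) (perPoly n R - C a) = 1 := by
  rw [coeff_sub, coeff_permMonomial_perPoly, coeff_C, if_neg (permMonomial_ne_zero ρ).symm, sub_zero]

omit [IsDomain R] in
/-- A nonzero monomial of `per_n − a` is a permutation monomial. [folklore] -/
theorem exists_permMonomial_eq_of_coeff_perPoly_sub_C_ne_zero (a : R) {d : (n × n) →₀ ℕ} (hd : d ≠ 0)
    (h : coeff d (perPoly n R - C a) ≠ 0) : ∃ ρ : Equiv.Perm n, permMonomial ρ = d := by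
  rw [coeff_sub, coeff_C, if_neg hd.symm, sub_zero] at h
  exact exists_permMonomial_eq_of_coeff_perPoly_ne_zero R h

/-- Every variable has degree exactly `1` in `per_n − a`. [folklore] -/
theorem degreeOf_perPoly_sub_C [Nonempty n] (a : R) (v : n × n) : degreeOf v (perPoly n R - C a) = 1 := by
  apply le_antisymm
  · rw [degreeOf_le_iff]
    intro d hd
    by_cases hd0 : d = 0
    · rw [hd0]; simp
    obtain ⟨ρ, rfl⟩ := exists_permMonomial_eq_of_coeff_perPoly_sub_C_ne_zero a hd0 (mem_support_iff.1 hd)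
    obtain ⟨r, c⟩ := v
    rw [permMonomial_apply]
    split_ifs <;> simp
  · obtain ⟨r, c⟩ := v
    have hmem : permMonomial (Equiv.swap c r) ∈ (perPoly n R - C a).support := by
      rw [mem_support_iff, coeff_permMonomial_perPoly_sub_C]; exact one_ne_zero
    have := monomial_le_degreeOf (r, c) hmem
    rwa [permMonomial_apply, Equiv.swap_apply_left, if_pos rfl] at this

omit [DecidableEq n] in
/-- `rowCount 0 = 0`. [folklore] -/
theorem rowCount_zero (r : n) : rowCount (0 : (n × n) →₀ ℕ) r = 0 := by
  simp [rowCount]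

omit [DecidableEq n] in
/-- `colCount 0 = 0`. [folklore] -/
theorem colCount_zero (c : n) : colCount (0 : (n × n) →₀ ℕ) c = 0 := by
  simp [colCount]

/-- Key step (von zur Gathen, shifted): if `g h = per_n − a`, the set of variables occurring in `g` is empty or everything.
[cite: Vonzurgathen1987, Thm. 3.4] -/
theorem vars_factor_perPoly_sub_C_trivial [Nonempty n] (a : R) {g h : MvPolynomial (n × n) R}
    (hgh : g * h = perPoly n R - C a) :
    (∀ d ∈ g.support, d = 0) ∨ (∀ d ∈ h.support, d = 0) := by
  classical
  have hne : g * h ≠ 0 := by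
    rw [hgh]; intro h0
    have := coeff_permMonomial_perPoly_sub_C a (1 : Equiv.Perm n)
    rw [h0, coeff_zero] at this
    exact zero_ne_one this
  have hg0 : g ≠ 0 := left_ne_zero_of_mul hne
  have hh0 : h ≠ 0 := right_ne_zero_of_mul hne
  have hdeg : ∀ v, degreeOf v g + degreeOf v h = 1 := fun v => by
    rw [← degreeOf_mul_eq hg0 hh0, hgh, degreeOf_perPoly_sub_C]
  set S : Finset (n × n) := Finset.univ.filter fun v => degreeOf v g ≠ 0 with hS
  have hgS : ∀ d ∈ g.support, ∀ v, d v ≠ 0 → v ∈ S := fun d hd v hv => by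
    rw [hS, Finset.mem_filter]
    refine ⟨Finset.mem_univ _, fun h0 => hv ?_⟩
    have := monomial_le_degreeOf v hd
    omega
  have hhS : ∀ d ∈ h.support, ∀ v, d v ≠ 0 → v ∉ S := fun d hd v hv hvS => by
    rw [hS, Finset.mem_filter] at hvS
    have h1 := monomial_le_degreeOf v hd
    have h2 := hdeg v
    omega
  -- (F1) every permutation monomial splits into a `g`-part and an `h`-part with non-zero coefficients
  have F1 : ∀ π : Equiv.Perm n,
      coeff ((permMonomial π).filter (· ∈ S)) g * coeff ((permMonomial π).filter (¬ · ∈ S)) h = 1 :=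
    fun π => by rw [← coeff_mul_of_separated S hgS hhS, hgh, coeff_permMonomial_perPoly_sub_C]
  -- (F2) hybrid monomials are zero or permutation monomials
  have F2 : ∀ π π' : Equiv.Perm n,
      (permMonomial π).filter (· ∈ S) + (permMonomial π').filter (¬ · ∈ S) = 0 ∨
      ∃ ρ : Equiv.Perm n, permMonomial ρ =
        (permMonomial π).filter (· ∈ S) + (permMonomial π').filter (¬ · ∈ S) := by
    intro π π'
    set ν := (permMonomial π).filter (· ∈ S) + (permMonomial π').filter (¬ · ∈ S) with hν
    by_cases hν0 : ν = 0
    · exact Or.inl hν0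
    right
    have e1 : ν.filter (· ∈ S) = (permMonomial π).filter (· ∈ S) := by
      ext v; simp only [hν, Finsupp.filter_apply, Finsupp.add_apply]
      by_cases hv : v ∈ S <;> simp [hv]
    have e2 : ν.filter (¬ · ∈ S) = (permMonomial π').filter (¬ · ∈ S) := by
      ext v; simp only [hν, Finsupp.filter_apply, Finsupp.add_apply]
      by_cases hv : v ∈ S <;> simp [hv]
    have hcoeff : coeff ν (g * h) ≠ 0 := by
      rw [coeff_mul_of_separated S hgS hhS, e1, e2]
      have ha := F1 π
      have hb := F1 π'
      exact mul_ne_zero (left_ne_zero_of_mul (ha.symm ▸ one_ne_zero))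
        (right_ne_zero_of_mul (hb.symm ▸ one_ne_zero))
    rw [hgh] at hcoeff
    exact exists_permMonomial_eq_of_coeff_perPoly_sub_C_ne_zero a hν0 hcoeff
  -- (F3) rows: `S` is a union of full rows
  have F3 : ∀ r b b', (r, b) ∈ S → (r, b') ∈ S := by
    intro r b b' hrb
    by_contra hb'
    have h2 : rowCount ((permMonomial (Equiv.swap b r)).filter (· ∈ S) +
        (permMonomial (Equiv.swap b' r)).filter (¬ · ∈ S)) r = 2 := by
      rw [rowCount_add, rowCount_filter_permMonomial, rowCount_filter_permMonomial,
        Equiv.symm_swap, Equiv.symm_swap, Equiv.swap_apply_right, Equiv.swap_apply_right,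
        if_pos hrb, if_pos hb']
    rcases F2 (Equiv.swap b r) (Equiv.swap b' r) with h0 | ⟨ρ, hρ⟩
    · rw [h0, rowCount_zero] at h2
      exact absurd h2 (by norm_num)
    · have := rowCount_permMonomial ρ r
      rw [hρ, h2] at this
      exact absurd this (by norm_num)
  -- (F4) columns: `S` is a union of full columns
  have F4 : ∀ c a₁ a₂, (a₁, c) ∈ S → (a₂, c) ∈ S := by
    intro c a₁ a₂ hac
    by_contra ha'
    have h2 : colCount ((permMonomial (Equiv.swap c a₁)).filter (· ∈ S) +
        (permMonomial (Equiv.swap c a₂)).filter (¬ · ∈ S)) c = 2 := by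
      rw [colCount_add, colCount_filter_permMonomial, colCount_filter_permMonomial,
        Equiv.swap_apply_left, Equiv.swap_apply_left, if_pos hac, if_pos ha']
    rcases F2 (Equiv.swap c a₁) (Equiv.swap c a₂) with h0 | ⟨ρ, hρ⟩
    · rw [h0, colCount_zero] at h2
      exact absurd h2 (by norm_num)
    · have := colCount_permMonomial ρ c
      rw [hρ, h2] at this
      exact absurd this (by norm_num)
  by_cases hSne : S.Nonempty
  · right
    obtain ⟨⟨a₀, b₀⟩, hab⟩ := hSne
    have hall : ∀ v : n × n, v ∈ S := fun ⟨i, j⟩ => F4 j a₀ i (F3 a₀ b₀ j hab)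
    intro d hd
    ext v
    by_contra hv
    exact hhS d hd v hv (hall v)
  · left
    intro d hd
    ext v
    by_contra hv
    exact hSne ⟨v, hgS d hd v hv⟩

/-- **`per_n − a` is irreducible** over any integral domain, for every constant `a` and every non-empty finite `n`
(von zur Gathen's proof of the irreducibility of `per_n`, run verbatim for the shifted polynomial: the constant term never
meets a permutation monomial). [cite: Vonzurgathen1987, Thm. 3.4] -/
theorem perPoly_sub_C_irreducible [Nonempty n] (a : R) : Irreducible (perPoly n R - C a) := by
  classical
  refine ⟨fun hu => ?_, fun g h hgh => ?_⟩
  · obtain ⟨u, hu⟩ := hu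
    obtain ⟨i⟩ := ‹Nonempty n›
    have h1 : degreeOf (i, i) (perPoly n R - C a) = 1 := degreeOf_perPoly_sub_C a (i, i)
    have hprod : (u : MvPolynomial (n × n) R) * (↑u⁻¹ : MvPolynomial (n × n) R) = 1 := by
      rw [← Units.val_mul, mul_inv_cancel, Units.val_one]
    have hu0 : (u : MvPolynomial (n × n) R) ≠ 0 := by
      rw [hu]; intro h0; rw [h0, degreeOf_zero] at h1; exact zero_ne_one h1
    have hui0 : (↑u⁻¹ : MvPolynomial (n × n) R) ≠ 0 := fun h0 => by
      rw [h0, mul_zero] at hprod; exact zero_ne_one hprod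
    have := degreeOf_mul_eq (n := (i, i)) hu0 hui0
    rw [hprod, degreeOf_one, hu, h1] at this
    omega
  · rcases vars_factor_perPoly_sub_C_trivial a hgh.symm with hg | hh
    · left
      have hgC := eq_C_of_support_subset_zero hg
      have key : coeff 0 g * coeff (permMonomial 1) h = 1 := by
        have := congrArg (coeff (permMonomial (1 : Equiv.Perm n))) hgh
        rw [coeff_permMonomial_perPoly_sub_C, hgC, coeff_C_mul] at this
        exact this.symm
      rw [hgC]
      exact (IsUnit.of_mul_eq_one _ key).map C
    · right
      have hhC := eq_C_of_support_subset_zero hh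
      have key : coeff (permMonomial 1) g * coeff 0 h = 1 := by
        have := congrArg (coeff (permMonomial (1 : Equiv.Perm n))) hgh
        rw [coeff_permMonomial_perPoly_sub_C, hhC, mul_comm, coeff_C_mul] at this
        rw [mul_comm]; exact this.symm
      rw [hhC]
      exact (IsUnit.of_mul_eq_one_right _ key).map C

end Shifted

/-! ## 2. The primes `P_c − α` of `ℂ[y]` -/

/-- Primality is preserved by renaming along an INJECTIVE map of variables. [folklore] -/
theorem prime_rename_of_injective {σ τ : Type*} {R : Type*} [CommRing R] {f : σ → τ}
    (hf : Function.Injective f) {p : MvPolynomial σ R} (hp : Prime p) : Prime (rename f p) := by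
  classical
  have h1 : rename f p = rename ((↑) : Set.range f → τ) (rename (Equiv.ofInjective f hf) p) := by
    rw [rename_rename]
    rfl
  rw [h1, MvPolynomial.prime_rename_iff]
  exact (MulEquiv.prime_iff (renameEquiv R (Equiv.ofInjective f hf))).2 hp

variable {m : ℕ}

/-- `P_c − α = (per_m − α)` renamed along the cell embedding of block `c`. [this file] -/
theorem kiPer_sub_C_eq_rename (m : ℕ) (c : Fin 3 → Fin (qOf m)) (α : ℂ) :
    kiPer m c - C α = rename (cellEmb m c) (perPoly (Fin m) ℂ - C α) := by
  rw [map_sub, rename_C, kiPer_eq_rename_cellEmb]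

/-- **Every shifted block permanent `P_c − α` is a prime of `ℂ[y]`** (`m ≥ 1`). [this file] -/
theorem kiPer_sub_C_prime (hm : 1 ≤ m) (c : Fin 3 → Fin (qOf m)) (α : ℂ) : Prime (kiPer m c - C α) := by
  haveI : Nonempty (Fin m) := ⟨⟨0, hm⟩⟩
  rw [kiPer_sub_C_eq_rename]
  exact prime_rename_of_injective (cellEmb m c).injective
    (UniqueFactorizationMonoid.irreducible_iff_prime.1 (perPoly_sub_C_irreducible α))

/-- `P_c − α` is not a unit. [this file] -/
theorem kiPer_sub_C_not_isUnit (hm : 1 ≤ m) (c : Fin 3 → Fin (qOf m)) (α : ℂ) : ¬ IsUnit (kiPer m c - C α) :=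
  (kiPer_sub_C_prime hm c α).not_unit

/-- **Distinct shifted block permanents are non-associated** (`m ≥ 3`): `P_c − α ~ P_{c'} − α'` forces `c = c'` and
`α = α'` (read off the diagonal monomial of `c`, which no other block contains). [this file] -/
theorem associated_kiPer_sub_C_iff (hm : 3 ≤ m) {c c' : Fin 3 → Fin (qOf m)} {α α' : ℂ} :
    Associated (kiPer m c - C α) (kiPer m c' - C α') ↔ c = c' ∧ α = α' := by
  classical
  constructor
  · rintro ⟨u, hu⟩
    obtain ⟨r, hr, hur⟩ := (MvPolynomial.isUnit_iff_eq_C_of_isReduced).1 u.isUnit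
    rw [hur] at hu
    -- coefficient of the diagonal monomial of `c`
    have hdiag0 : diagMonomial m c ≠ 0 := by
      intro h0
      have := card_support_diagMonomial m c
      rw [h0, Finsupp.support_zero, Finset.card_empty] at this
      omega
    have key := congrArg (coeff (diagMonomial m c)) hu
    rw [mul_comm, coeff_C_mul, coeff_sub, coeff_sub, coeff_C, coeff_C, if_neg hdiag0.symm, if_neg hdiag0.symm,
      sub_zero, sub_zero, coeff_diagMonomial_kiPer_self] at key
    have hcc : c = c' := by
      by_contra hne
      rw [coeff_diagMonomial_kiPer_ne hm (Ne.symm hne)] at key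
      simp only [mul_one] at key
      rw [key] at hr
      exact not_isUnit_zero hr
    subst hcc
    refine ⟨rfl, ?_⟩
    rw [coeff_diagMonomial_kiPer_self, mul_one] at key
    rw [key, C_1, mul_one, sub_right_inj, C_inj] at hu
    exact hu
  · rintro ⟨rfl, rfl⟩
    exact Associated.refl _

/-- Hence `P_c − α ∣ P_{c'} − α'` only if `(c, α) = (c', α')`. [this file] -/
theorem kiPer_sub_C_dvd_iff (hm : 3 ≤ m) {c c' : Fin 3 → Fin (qOf m)} {α α' : ℂ} :
    kiPer m c - C α ∣ kiPer m c' - C α' ↔ c = c' ∧ α = α' := by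
  have h1 : 1 ≤ m := by omega
  rw [(kiPer_sub_C_prime h1 c α).irreducible.dvd_irreducible_iff_associated (kiPer_sub_C_prime h1 c' α').irreducible]
  exact associated_kiPer_sub_C_iff hm

/-! ## 3. Transcendence of a single block permanent -/


/-- **Each block permanent is transcendental**: `h(P_c) = 0 ⇒ h = 0` (`m ≥ 1`). [this file] -/
theorem aeval_kiPer_eq_zero_iff (hm : 1 ≤ m) (c : Fin 3 → Fin (qOf m)) (h : ℂ[X]) :
    Polynomial.aeval (kiPer m c) h = 0 ↔ h = 0 := by
  constructor
  · intro h0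
    have hT := kiPer_algebraicIndependent m {c} (by
      rw [Finset.card_singleton]; have := Nat.mul_pos hm hm; omega)
    have ht := hT.transcendental ⟨c, Finset.mem_singleton_self c⟩
    by_contra hne
    exact ht ⟨h, hne, h0⟩
  · rintro rfl
    rw [map_zero]

end Summit.ValiantsHypothesis.ValiantsHypothesis.Theorems.DefinabilityGapShiftedPrimes
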